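import Mathlib
import Summits.NavierStokesRegularity.NavierStokesRegularity.Theorems.AxisTwistDoorTiltDominationLocAxisymmetricExclusion
import Summits.NavierStokesRegularity.NavierStokesRegularity.Theorems.AxisTwistDoorTiltDominationLocSymmetryExclusions
import Summits.NavierStokesRegularity.NavierStokesRegularity.Theorems.AxisTwistDoorAveragedConeLiouvilleShellFact
import Summits.NavierStokesRegularity.NavierStokesRegularity.Theorems.AxisTwistDoorAveragedConeLiouvilleRegularShell
import Summits.NavierStokesRegularity.NavierStokesRegularity.Theorems.AxisTwistDoorAveragedConeLiouvillePositivityCover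
import Summits.NavierStokesRegularity.NavierStokesRegularity.Theorems.TerminalTraceTypeITraceScarL3ApexPackageTranslate
import Summits.NavierStokesRegularity.NavierStokesRegularity.Theorems.FarPastLedger.Negative.Scaling
import Summits.NavierStokesRegularity.NavierStokesRegularity.Theorems.PoloidalWindowDoorPoloidalWindowRigidityWindow
import Literature.Analysis.FluidPDE.LocalTypeICongr
import Literature.Analysis.FluidPDE.LocalTypeIScaling
import Literature.Analysis.FluidPDE.LerayHopfNSRescale
import Literature.Analysis.FluidPDE.AxisymmetricVorticityTransport
import HarnessLib

/-!
# AxisTwistDoor · crux `TiltDominationLoc` (stmt-NavierStokesRegularity-26991, wall W3) — NO SINGULAR SEGMENT through the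
# apex, hence NO SCREW (HELICAL) SYMMETRY (portrait clause (xiii))

Helper file of the LEAD (ns-atd-p1 g5; `--supports stmt-NavierStokesRegularity-26991 --as helper`).  No definitions.

Lei–Ren's quantitative regular shell (arXiv:2501.08976 Lemma 2.4 = Lei–Ren 2024; tree: the class-specialised
`ShellFact`, PROVED `…AveragedConeLiouville.Shell.shellFact_holds`) gives EVERY profile of the route's energy class —
automatic for the Type-I ancient Oseen-mild core class (`exists_energyClass_of_typeI`) — a cylindrical shell
`{a−δ < |x_h| < a+δ, |x₃| < a+δ}`, `2/3 < a < 4/5`, on which `|v| ≤ B` for ALL times `−(a+δ)² < t < 0`.  The points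
of that shell are therefore NOT backward-singular at time `0`; in particular the point `a e₂` of the horizontal ray
`ℝ₊e₂`.  Rotations, translations and Navier–Stokes scalings act on the class and move backward-singular points
covariantly, so:

* `exists_not_isBackwardSingularPoint_on_ray` — a regular point `(0, a e₂)`, `1/2 < a < 1`, on the `e₂`-ray;
* `not_singular_segment` — **no class profile is backward-singular (at time 0) at every point of a segment `[0, e]`,
  `e ≠ 0`** (rotate `e/‖e‖` to `e₂`, rescale by `‖e‖`);
* `not_isBackwardSingularPoint_of_screwInvariant` — **portrait clause (xiii): the W3 counterexample has no screw
  symmetry about the apex axis**: if `v(t)(R_θ x + κθ e₃) = R_θ v(t)(x)` for all `θ` (helical symmetry of reduced pitch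
  `κ`; `κ = 0` is axisymmetry, clause (xii) `…AxisymmetricExclusion`), the apex is not backward-singular — for `κ ≠ 0` the
  orbit of the apex under the screw motions is the whole axis, every point of which would be singular.

Together with (v)–(vii), (xii): the hypothetical one-signed Type-I blow-up profile is not self-similar, not invariant
along any line, not axisymmetric and not helical about its apex axis — it carries no continuous spatial symmetry fixing
or sliding the apex axis.  HONEST FRAMING: statements about HYPOTHETICAL Type-I blow-up profiles; W3 (26991), W4, W6, the
leaf and Navier–Stokes regularity (Clay A) are OPEN; nothing here is an NS regularity statement.
[cite: LeiRenTian2025, Lemma 2.4 (arXiv:2501.08976 p. 7)] [cite: LeiRen2024QuantitativePartialRegularity, Thm 2]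
[cite: AlbrittonBarker2019, §1 (backward singular points), §3 (translation and scaling)]
-/

noncomputable section

-- the summit and its single sub-problem share the name (CONVENTIONS §1), as in every Theorems file
set_option linter.dupNamespace false

namespace Summit.NavierStokesRegularity.NavierStokesRegularity.Theorems.AxisTwistDoorTiltDominationLocNoSingularSegment

open Set Function MeasureTheory Filter Metric
open scoped InnerProductSpace ENNReal
open Literature.Analysis Literature.Analysis.FluidPDE
open Summit.NavierStokesRegularity.NavierStokesRegularity.Theorems
open Summit.NavierStokesRegularity.NavierStokesRegularity.Theorems.AxisTwistDoorAveragedConeLiouvilleDefs (InClass cylPt)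
open Summit.NavierStokesRegularity.NavierStokesRegularity.Theorems.AxisTwistDoorTiltDominationLocEnergyClass
  (exists_energyClass_of_typeI)
open Summit.NavierStokesRegularity.NavierStokesRegularity.Theorems.AxisTwistDoorTiltDominationLocAxisymmetricExclusion
  (not_isBackwardSingularPoint_of_isAxisymmetric)
open Summit.NavierStokesRegularity.NavierStokesRegularity.Theorems.AxisTwistDoorTiltDominationLocSymmetryExclusions
  (exists_linearIsometryEquiv_apply_eq_single_one)
open Summit.NavierStokesRegularity.NavierStokesRegularity.Theorems.PoloidalWindowDoorPoloidalWindowRigidityRotate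
  (class_conj_linearIsometryEquiv)
open Summit.NavierStokesRegularity.NavierStokesRegularity.Theorems.PoloidalWindowDoorPoloidalWindowRigidityWindow
  (isTypeIAncientMild_of_class)
open Summit.NavierStokesRegularity.NavierStokesRegularity.Theorems.FarPastLedger.Negative (isTypeIAncientMild_nsRescale)
open Summit.NavierStokesRegularity.NavierStokesRegularity.Theorems.RellichScarSimilarityCovariance
  (LIE.isBackwardSingularPoint_zero_conj)
open Summit.NavierStokesRegularity.NavierStokesRegularity.Theorems.TypeITraceScarL3 (isBackwardSingularPoint_translate_zero_iff)
open Summit.NavierStokesRegularity.NavierStokesRegularity.Theorems.AveragedConeLiouville.RegularShell (lipschitzWith_cylRadius)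
open Summit.NavierStokesRegularity.NavierStokesRegularity.Theorems.AveragedConeLiouville.PositivityCover (abs_apply_le_norm)

variable {C : ℝ} {v : ℝ → EuclideanSpace ℝ (Fin 3) → EuclideanSpace ℝ (Fin 3)}

/-! ### §0 Covariance of backward-singular points at time `0` -/

/-- Backward singularity at `(0, x₀)` only sees the field at negative times. [cite: AlbrittonBarker2019, §1] -/
theorem isBackwardSingularPoint_congr_slab {u w : ℝ → EuclideanSpace ℝ (Fin 3) → EuclideanSpace ℝ (Fin 3)}
    (h : ∀ t < (0 : ℝ), ∀ x, u t x = w t x) (x₀ : EuclideanSpace ℝ (Fin 3))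
    (hu : IsBackwardSingularPoint u ((0 : ℝ), x₀)) : IsBackwardSingularPoint w ((0 : ℝ), x₀) := by
  refine hu.congr_ae (S := Iio (0 : ℝ) ×ˢ (univ : Set (EuclideanSpace ℝ (Fin 3)))) (fun r hr z hz => ?_) ?_
  · rw [mem_parabolicCylinder] at hz
    exact mk_mem_prod (by simpa using hz.1.2) (mem_univ _)
  · refine ae_restrict_of_forall_mem (measurableSet_Iio.prod MeasurableSet.univ) ?_
    rintro ⟨t, x⟩ hz
    exact h t (mem_prod.1 hz).1 x

/-- A uniform bound near `(0, x₀)` excludes backward singularity there. [cite: AlbrittonBarker2019, §1] -/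
theorem not_isBackwardSingularPoint_of_norm_le {u : ℝ → EuclideanSpace ℝ (Fin 3) → EuclideanSpace ℝ (Fin 3)}
    {x₀ : EuclideanSpace ℝ (Fin 3)} {r M : ℝ} (hr : 0 < r)
    (h : ∀ t : ℝ, -r ^ 2 < t → t < 0 → ∀ x ∈ ball x₀ r, ‖u t x‖ ≤ M) :
    ¬ IsBackwardSingularPoint u ((0 : ℝ), x₀) := by
  intro hs
  have hbound : ∀ z ∈ parabolicCylinder r (((0 : ℝ), x₀) : ℝ × EuclideanSpace ℝ (Fin 3)), ‖uncurry u z‖ ≤ M := by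
    rintro ⟨t, x⟩ hz
    rw [mem_parabolicCylinder] at hz
    obtain ⟨⟨ht1, ht2⟩, hdist⟩ := hz
    exact h t (by simpa using ht1) (by simpa using ht2) x (by simpa using hdist)
  have hlt : eLpNorm (uncurry u) ∞
      (volume.restrict (parabolicCylinder r (((0 : ℝ), x₀) : ℝ × EuclideanSpace ℝ (Fin 3)))) < ⊤ := by
    rw [eLpNorm_exponent_top]
    exact eLpNormEssSup_lt_top_of_ae_bound
      (ae_restrict_of_forall_mem (isOpen_parabolicCylinder r _).measurableSet hbound)
  exact hlt.ne (hs r hr)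

/-- **Navier–Stokes scaling moves backward-singular points**: `(0, y)` is backward singular for
`c v(c²·, c·)` iff `(0, c y)` is for `v` (`c > 0`). [cite: AlbrittonBarker2019, §3] -/
theorem isBackwardSingularPoint_nsRescale_iff {c : ℝ} (hc : 0 < c)
    (u : ℝ → EuclideanSpace ℝ (Fin 3) → EuclideanSpace ℝ (Fin 3)) (y : EuclideanSpace ℝ (Fin 3)) :
    IsBackwardSingularPoint (nsRescale c u) ((0 : ℝ), y) ↔ IsBackwardSingularPoint u ((0 : ℝ), c • y) := by
  have key : ∀ r : ℝ,
      eLpNorm (uncurry (nsRescale c u)) ∞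
          (volume.restrict (parabolicCylinder r (((0 : ℝ), y) : ℝ × EuclideanSpace ℝ (Fin 3)))) =
        ENNReal.ofReal c * eLpNorm (uncurry u) ∞
          (volume.restrict (parabolicCylinder (c * r) (((0 : ℝ), c • y) : ℝ × EuclideanSpace ℝ (Fin 3)))) := by
    intro r
    have h := eLpNorm_top_nsZoom hc 0 (0 : EuclideanSpace ℝ (Fin 3)) r (((0 : ℝ), y) : ℝ × EuclideanSpace ℝ (Fin 3)) u
    rw [← Literature.Analysis.FluidPDE.nsRescale_eq_smul_stPull, stAffine_apply, mul_zero, add_zero, zero_add] at h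
    exact h
  have hc0 : ENNReal.ofReal c ≠ 0 := (ENNReal.ofReal_pos.2 hc).ne'
  constructor
  · intro h r hr
    have h1 := h (r / c) (div_pos hr hc)
    rw [key, mul_div_cancel₀ _ hc.ne'] at h1
    rcases ENNReal.mul_eq_top.1 h1 with h2 | h2
    · exact h2.2
    · exact absurd h2.1 ENNReal.ofReal_ne_top
  · intro h r hr
    rw [key, h (c * r) (mul_pos hc hr), ENNReal.mul_top hc0]

/-- **Linear isometries move backward-singular points**: if `(0, x)` is backward singular for `v`, then `(0, L x)` is
for the conjugate `t ↦ L ∘ v(t) ∘ L⁻¹` (translate to the origin, conjugate there, translate back).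
[cite: AlbrittonBarker2019, §3] -/
theorem isBackwardSingularPoint_conj (L : EuclideanSpace ℝ (Fin 3) ≃ₗᵢ[ℝ] EuclideanSpace ℝ (Fin 3))
    {x : EuclideanSpace ℝ (Fin 3)} (h : IsBackwardSingularPoint v ((0 : ℝ), x)) :
    IsBackwardSingularPoint (fun t y => L (v t (L.symm y))) ((0 : ℝ), L x) := by
  have h1 : IsBackwardSingularPoint (fun s y => v s (y + x)) 0 := (isBackwardSingularPoint_translate_zero_iff x v).2 h
  have h2 := LIE.isBackwardSingularPoint_zero_conj L h1
  have h3 : (fun t y => L ((fun s y => v s (y + x)) t (L.symm y))) =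
      fun s y => (fun t y => L (v t (L.symm y))) s (y + L x) := by
    funext s y
    simp only [map_add, LinearIsometryEquiv.symm_apply_apply]
  rw [h3] at h2
  exact (isBackwardSingularPoint_translate_zero_iff (L x) _).1 h2

/-! ### §1 A regular point on the horizontal ray, from the quantitative regular shell -/

/-- Every point off the vertical axis is a cylindrical point `(r cos θ, r sin θ, z)` with `r > 0`, `r² = y₀² + y₁²`,
`z = y₂` (polar form of `(y₀, y₁) ≠ 0`; the route's `…TiltDominationLocRigidity.exists_cyl_repr`, restated here to keep
this file out of the route file's import cone). -/
theorem exists_cylPt_eq_of_ne (y : EuclideanSpace ℝ (Fin 3)) (hy : y 0 ≠ 0 ∨ y 1 ≠ 0) :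
    ∃ r θ : ℝ, 0 < r ∧ r ^ 2 = y 0 ^ 2 + y 1 ^ 2 ∧ cylPt r θ (y 2) = y := by
  set w : ℂ := ⟨y 0, y 1⟩ with hw
  have hw0 : w ≠ 0 := by
    intro h
    rcases hy with h0 | h1
    · exact h0 (by simpa [hw] using congrArg Complex.re h)
    · exact h1 (by simpa [hw] using congrArg Complex.im h)
  have hr : 0 < ‖w‖ := norm_pos_iff.2 hw0
  have hcos : ‖w‖ * Real.cos (Complex.arg w) = y 0 := by rw [Complex.norm_mul_cos_arg]
  have hsin : ‖w‖ * Real.sin (Complex.arg w) = y 1 := by rw [Complex.norm_mul_sin_arg]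
  have hsq : ‖w‖ ^ 2 = y 0 ^ 2 + y 1 ^ 2 := by
    rw [← Complex.normSq_eq_norm_sq, Complex.normSq_apply]; ring
  refine ⟨‖w‖, Complex.arg w, hr, hsq, ?_⟩
  ext i
  fin_cases i
  · simp [cylPt, hcos]
  · simp [cylPt, hsin]
  · simp [cylPt]

/-- The cylindrical radius of `a e₂` is `|a|`. -/
theorem cylRadius_smul_single_one (a : ℝ) :
    cylRadius (a • (EuclideanSpace.single (1 : Fin 3) (1 : ℝ) : EuclideanSpace ℝ (Fin 3))) = |a| := by
  rw [cylRadius]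
  simp [Real.sqrt_sq_eq_abs]

/-- **A regular point on the `e₂`-ray.**  Every Type-I ancient Oseen-mild profile (rate, continuity on the open slab,
Oseen identity, divergence-free slices) has a point `(0, a e₂)`, `1/2 < a < 1`, of the horizontal ray through the apex
which is NOT backward-singular: the energy class is automatic, Lei–Ren's regular shell `{a−δ < |x_h| < a+δ, |x₃| < a+δ}`
carries `|v| ≤ B` for `−(a+δ)² < t < 0`, and the ball `B(a e₂, δ)` lies in the shell (the distance to the axis is
`1`-Lipschitz). [cite: LeiRenTian2025, Lemma 2.4 (arXiv:2501.08976 p. 7); AlbrittonBarker2019, §1] -/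
theorem exists_not_isBackwardSingularPoint_on_ray (hrate : HasTypeITimeDecay C v)
    (hcont : ContinuousOn (uncurry v) (Iio (0 : ℝ) ×ˢ univ))
    (hmild : ∀ s t : ℝ, s < t → t < 0 → ∀ x,
      v t x = UnboundedOperators.heatExtension (v s) (t - s) x - oseenDuhamel 1 s v v t x)
    (hdiv : ∀ t < 0, VectorCalculus.IsDivFree (v t)) :
    ∃ a : ℝ, 1 / 2 < a ∧ a < 1 ∧
      ¬ IsBackwardSingularPoint v ((0 : ℝ), a • (EuclideanSpace.single (1 : Fin 3) (1 : ℝ) : EuclideanSpace ℝ (Fin 3))) := by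
  obtain ⟨π, H, hsw, hwg, hI⟩ := exists_energyClass_of_typeI hrate hcont hmild hdiv
  have hcl : InClass C v π H := ⟨hrate, hcont, hmild, hdiv, hsw, hwg, hI⟩
  obtain ⟨δ₀, B, hδ₀, -, hshell⟩ :=
    AveragedConeLiouville.Shell.shellFact_holds (typeIBound (Iio (0 : ℝ) ×ˢ univ) v π H) hI
  obtain ⟨a, δ, ha1, ha2, hδ1, hδ2, hbd⟩ := hshell C v π H hcl le_rfl
  have hδ : 0 < δ := hδ₀.trans_le hδ1
  set e₂ : EuclideanSpace ℝ (Fin 3) := EuclideanSpace.single (1 : Fin 3) (1 : ℝ) with he₂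
  refine ⟨a, by linarith, by linarith, ?_⟩
  -- the velocity bound on the ball `B(a e₂, δ)` for `−δ² < t < 0`
  have hball : ∀ t : ℝ, -δ ^ 2 < t → t < 0 → ∀ y ∈ ball (a • e₂) δ, ‖v t y‖ ≤ B := by
    intro t ht1 ht2 y hy
    rw [mem_ball, dist_eq_norm] at hy
    have hra : cylRadius (a • e₂) = a := by rw [he₂, cylRadius_smul_single_one, abs_of_pos (by linarith)]
    have hr : |cylRadius y - a| < δ := by
      have h := lipschitzWith_cylRadius.dist_le_mul y (a • e₂)
      rw [NNReal.coe_one, one_mul, Real.dist_eq, hra, dist_eq_norm] at h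
      exact h.trans_lt hy
    obtain ⟨hr1, hr2⟩ := abs_lt.1 hr
    have hz : |y 2| < a + δ := by
      have h1 : |(y - a • e₂) 2| ≤ ‖y - a • e₂‖ := abs_apply_le_norm (y - a • e₂) 2
      have h2 : (y - a • e₂) 2 = y 2 := by simp [he₂]
      rw [h2] at h1
      linarith
    have hy01 : y 0 ≠ 0 ∨ y 1 ≠ 0 := by
      by_contra h0
      push Not at h0
      have : cylRadius y = 0 := by rw [cylRadius, h0.1, h0.2]; simp
      linarith
    obtain ⟨r, θ, hrpos, hr2sq, hyeq⟩ := exists_cylPt_eq_of_ne y hy01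
    have hrr : r = cylRadius y := by
      rw [cylRadius, ← hr2sq, Real.sqrt_sq hrpos.le]
    have ht1' : -(a + δ) ^ 2 < t := by nlinarith
    have key := (hbd t ht1' ht2 r θ (y 2) (by rw [hrr]; linarith) (by rw [hrr]; linarith) hz).1
    rwa [hyeq] at key
  -- translate `a e₂` to the origin
  have h0 : ¬ IsBackwardSingularPoint (fun s y => v s (y + a • e₂)) 0 := by
    refine fun hs => not_isBackwardSingularPoint_of_norm_le (u := fun s y => v s (y + a • e₂)) (x₀ := 0) hδ
      (fun t ht1 ht2 y hy => hball t ht1 ht2 (y + a • e₂) ?_) ?_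
    · rw [mem_ball, dist_eq_norm, add_sub_cancel_right]
      rwa [mem_ball_zero_iff] at hy
    · exact hs
  rwa [isBackwardSingularPoint_translate_zero_iff] at h0

/-! ### §2 No singular segment through the apex -/

/-- **No Type-I ancient mild profile is backward-singular along a whole segment `[0, e]`, `e ≠ 0`, at time `0`.**
Rotate `e/‖e‖` to `e₂` (`exists_linearIsometryEquiv_apply_eq_single_one`; the class is rotation-covariant), rescale
by `‖e‖` (the class is scaling-invariant), and meet the regular point of §1 on the `e₂`-ray.
[cite: LeiRenTian2025, Lemma 2.4 (arXiv:2501.08976 p. 7); AlbrittonBarker2019, §3] -/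
theorem not_singular_segment (hrate : HasTypeITimeDecay C v)
    (hcont : ContinuousOn (uncurry v) (Iio (0 : ℝ) ×ˢ univ))
    (hmild : ∀ s t : ℝ, s < t → t < 0 → ∀ x,
      v t x = UnboundedOperators.heatExtension (v s) (t - s) x - oseenDuhamel 1 s v v t x)
    (hdiv : ∀ t < 0, VectorCalculus.IsDivFree (v t)) {e : EuclideanSpace ℝ (Fin 3)} (he : e ≠ 0)
    (hseg : ∀ s : ℝ, 0 ≤ s → s ≤ 1 → IsBackwardSingularPoint v ((0 : ℝ), s • e)) : False := by
  have hn : 0 < ‖e‖ := norm_pos_iff.2 he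
  set e₂ : EuclideanSpace ℝ (Fin 3) := EuclideanSpace.single (1 : Fin 3) (1 : ℝ) with he₂
  -- a linear isometry with `L e = ‖e‖ e₂`
  have hunit : ‖(‖e‖⁻¹ : ℝ) • e‖ = 1 := by
    rw [norm_smul, Real.norm_of_nonneg (inv_nonneg.2 hn.le), inv_mul_cancel₀ hn.ne']
  obtain ⟨R, hR⟩ := exists_linearIsometryEquiv_apply_eq_single_one hunit
  set L := R.symm with hL
  have hLe : L e = ‖e‖ • e₂ := by
    have h1 : L ((‖e‖⁻¹ : ℝ) • e) = e₂ := by rw [hL, ← hR, LinearIsometryEquiv.symm_apply_apply]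
    rw [map_smul] at h1
    calc L e = ‖e‖ • ((‖e‖⁻¹ : ℝ) • L e) := by rw [smul_smul, mul_inv_cancel₀ hn.ne', one_smul]
      _ = ‖e‖ • e₂ := by rw [h1]
  -- the rotated and rescaled profile
  obtain ⟨hrate', hcont', hmild', hdiv'⟩ := class_conj_linearIsometryEquiv L hrate hcont hmild hdiv
  set w : ℝ → EuclideanSpace ℝ (Fin 3) → EuclideanSpace ℝ (Fin 3) :=
    nsRescale ‖e‖ (fun t y => L (v t (L.symm y))) with hw_def
  have hw : IsTypeIAncientMild C w :=
    isTypeIAncientMild_nsRescale (isTypeIAncientMild_of_class hrate' hcont' hmild' hdiv') hn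
  have hsegw : ∀ s : ℝ, 0 ≤ s → s ≤ 1 → IsBackwardSingularPoint w ((0 : ℝ), s • e₂) := by
    intro s hs0 hs1
    rw [hw_def, isBackwardSingularPoint_nsRescale_iff hn]
    have h := isBackwardSingularPoint_conj L (hseg s hs0 hs1)
    rwa [map_smul, hLe, smul_comm] at h
  obtain ⟨a, ha1, ha2, hreg⟩ := exists_not_isBackwardSingularPoint_on_ray hw.hasTypeITimeDecay hw.continuousOn_uncurry
    (fun s t hst ht x => hw.mild_eq_heatExtension hst ht x) (fun t ht => hw.isDivFree ht)
  exact hreg (hsegw a (by linarith) ha2.le)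

/-! ### §3 Screw (helical) symmetry about the apex axis is excluded -/

/-- **Portrait clause (xiii): no screw symmetry.**  If a Type-I ancient Oseen-mild profile is invariant under the screw
motions about the vertical axis with reduced pitch `κ` — `v(t)(R_θ x + κθ e₃) = R_θ v(t)(x)` for all `θ ∈ ℝ`, `x`,
`t < 0` (`κ = 0`: axisymmetric; `κ ≠ 0`: helically symmetric with pitch `2π|κ|`) — then the apex is NOT backward-
singular.  For `κ = 0` this is clause (xii) (`…AxisymmetricExclusion`, Seregin–Šverák); for `κ ≠ 0` the apex
singularity would propagate along the orbit `{κθ e₃}` = the whole axis (translation and rotation covariance of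
backward singularity), contradicting §2. [cite: LeiRenTian2025, Lemma 2.4; SereginSverak2009, Thm. 3.1] -/
theorem not_isBackwardSingularPoint_of_screwInvariant (hrate : HasTypeITimeDecay C v)
    (hcont : ContinuousOn (uncurry v) (Iio (0 : ℝ) ×ˢ univ))
    (hmild : ∀ s t : ℝ, s < t → t < 0 → ∀ x,
      v t x = UnboundedOperators.heatExtension (v s) (t - s) x - oseenDuhamel 1 s v v t x)
    (hdiv : ∀ t < 0, VectorCalculus.IsDivFree (v t)) (κ : ℝ)
    (hscrew : ∀ t < (0 : ℝ), ∀ (θ : ℝ) (x : EuclideanSpace ℝ (Fin 3)),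
      v t (rotZ θ x + (κ * θ) • EuclideanSpace.single (2 : Fin 3) (1 : ℝ)) = rotZ θ (v t x)) :
    ¬ IsBackwardSingularPoint v 0 := by
  by_cases hκ : κ = 0
  · refine not_isBackwardSingularPoint_of_isAxisymmetric hrate hcont hmild hdiv fun t ht θ x => ?_
    have h := hscrew t ht θ x
    rwa [hκ, zero_mul, zero_smul, add_zero] at h
  · intro hsing
    refine not_singular_segment hrate hcont hmild hdiv (e := EuclideanSpace.single (2 : Fin 3) (1 : ℝ))
      (fun h0 => by simpa using congrArg (fun w : EuclideanSpace ℝ (Fin 3) => w 2) h0) fun s _ _ => ?_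
    -- the apex singularity propagates to `(0, s e₃)` along the screw motion with angle `θ = s/κ`
    set θ : ℝ := s / κ with hθ
    have hc : κ * θ = s := by rw [hθ]; field_simp
    have h1 : IsBackwardSingularPoint (fun t y => rotZLIE θ (v t ((rotZLIE θ).symm y))) 0 :=
      LIE.isBackwardSingularPoint_zero_conj (rotZLIE θ) hsing
    have h2 : IsBackwardSingularPoint (fun t y => v t (y + s • EuclideanSpace.single (2 : Fin 3) (1 : ℝ)))
        ((0 : ℝ), (0 : EuclideanSpace ℝ (Fin 3))) := by
      refine isBackwardSingularPoint_congr_slab (fun t ht y => ?_) 0 h1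
      show rotZLIE θ (v t ((rotZLIE θ).symm y)) = v t (y + s • EuclideanSpace.single (2 : Fin 3) (1 : ℝ))
      rw [rotZLIE_apply, rotZLIE_symm_apply]
      have h := hscrew t ht θ (rotZ (-θ) y)
      rw [← rotZ_add, add_neg_cancel, rotZ_zero, hc] at h
      exact h.symm
    exact (isBackwardSingularPoint_translate_zero_iff (s • EuclideanSpace.single (2 : Fin 3) (1 : ℝ)) v).1 h2

end Summit.NavierStokesRegularity.NavierStokesRegularity.Theorems.AxisTwistDoorTiltDominationLocNoSingularSegment

end
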